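import Summits.QuantumFields.YangMills.Theorems.QuantileBitPurityFluxReflectionWeights
import HarnessLib

/-!
# Flux reflection III: a twisted ODD kernel ring is controlled by the untwisted ring's sign-flip, zero, band and bad-bond weights

Support module (`--supports` stmt-QuantumFields-24093, `QuantileBitPurity.EquatorBandVanishing`; seat ym-dw-p1 g17, LINE g12-B of ideator seat ym-idea-4).
The ELECTRIC-FLUX LEVER of the line in abstract form.  On a finite measure space `(Y, ρ)` let `Ψ ≥ 0` be bounded, jointly measurable and SYMMETRIC (the
gauge-averaged half-ring kernel), `K ≥ 0` bounded measurable symmetric and positive semi-definite on bounded measurable functions (the transfer kernel),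
`T` measure preserving (the centre twist at the seam) and `O : Y → ℝ` measurable and ODD under `T` (`O ∘ T = −O`; the sign of `Re tr` of the `x`-Polyakov
holonomy).  Along the twisted ring `x → a → a' → T x` the bit must vanish at `x` or flip on the first half, on the second half, or across the middle bond
(`one_le_bracket`); a flip across a `close` middle bond puts both ends in the band `B` (`flip_le`); and Cauchy–Schwarz in the positive form of `K`
(`cs_term`, from `QuantileBitPurityFluxReflectionForm`) turns each half-ring flip into an UNTWISTED weight:

★ `twisted_le_odd`:
`∫Ψ(x,a)K(a,a')Ψ(a',Tx) ≤ (∫ΨKΨ)^{1/2}·(2(∫Ψ𝟙_{flip}K𝟙_{flip}Ψ)^{1/2} + (∫𝟙_{O=0}ΨKΨ)^{1/2}) + ∫Ψ𝟙_B K𝟙_B Ψ + ∫ΨK𝟙_{¬close}Ψ(·,T·)`.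

In the lattice instantiation (companions `QuantileBitPurityFlux*`) the left side is the total weight of an `x`-twisted seam sector and the right side consists of
PERIODIC-sector weights of a thin equator band plus bad fields — electric-flux suppression without semiclassics.  Pure measure theory (Mathlib only).
HONEST FRAMING: an inequality between integrals; nothing about infinite volume, the continuum limit or the Clay gap.  No `sorry`, no new axiom, no new
definition.  References: [folklore] (Cauchy–Schwarz); E. T. Tomboulis, L. G. Yaffe, CMP 100 (1985) 313 and [cite: tHooft1979] for the twisted rings it serves.
-/

set_option autoImplicit false

noncomputable section

open MeasureTheory Real Function Set

namespace Summit.QuantumFields.YangMills.Theorems.FemtoTransferGap.FluxReflection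

variable {Y : Type*} [MeasurableSpace Y] {ρ : Measure Y} [IsFiniteMeasure ρ]

/-! ## §6 The odd ring: `twisted ≤ √untwisted · (2√flip + √zero) + band + bad` -/

section Odd

variable {Ψ K : Y → Y → ℝ} {CΨ CK : ℝ}

omit [MeasurableSpace Y] in
/-- The combinatorial heart: if the bit is odd under `T` then at every point of the twisted ring either the base bit vanishes, or the bit
flips on the first half, or on the second half, or across the middle bond. [folklore] -/
theorem one_le_bracket {T : Y → Y} {O : Y → ℝ} (hOT : ∀ y, O (T y) = -O y) (x a a' : Y) :
    (1 : ℝ) ≤ {y | O y = 0}.indicator (fun _ => (1 : ℝ)) x + {b | O b ≠ O x}.indicator (fun _ => (1 : ℝ)) a +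
      {b | O b ≠ O (T x)}.indicator (fun _ => (1 : ℝ)) a' + {q : Y × Y | O q.1 ≠ O q.2}.indicator (fun _ => (1 : ℝ)) (a, a') := by
  have h0 : ∀ (s : Set Y) (y : Y), 0 ≤ s.indicator (fun _ => (1 : ℝ)) y := fun s y => Set.indicator_nonneg (fun _ _ => zero_le_one) _
  have h0' : 0 ≤ {q : Y × Y | O q.1 ≠ O q.2}.indicator (fun _ => (1 : ℝ)) (a, a') := Set.indicator_nonneg (fun _ _ => zero_le_one) _
  by_cases hx : O x = 0
  · have : {y | O y = 0}.indicator (fun _ => (1 : ℝ)) x = 1 := Set.indicator_of_mem (by exact hx) _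
    linarith [h0 {b | O b ≠ O x} a, h0 {b | O b ≠ O (T x)} a']
  by_cases ha : O a = O x
  · by_cases ha' : O a' = O (T x)
    · have hne : O a ≠ O a' := by
        rw [ha, ha', hOT]
        intro h
        exact hx (by linarith)
      have : {q : Y × Y | O q.1 ≠ O q.2}.indicator (fun _ => (1 : ℝ)) (a, a') = 1 := Set.indicator_of_mem (by exact hne) _
      linarith [h0 {y | O y = 0} x, h0 {b | O b ≠ O x} a, h0 {b | O b ≠ O (T x)} a']
    · have : {b | O b ≠ O (T x)}.indicator (fun _ => (1 : ℝ)) a' = 1 := Set.indicator_of_mem (by exact ha') _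
      linarith [h0 {y | O y = 0} x, h0 {b | O b ≠ O x} a]
  · have : {b | O b ≠ O x}.indicator (fun _ => (1 : ℝ)) a = 1 := Set.indicator_of_mem (by exact ha) _
    linarith [h0 {y | O y = 0} x, h0 {b | O b ≠ O (T x)} a']

omit [MeasurableSpace Y] in
/-- A flip across a `close` bond sits in the band: `𝟙_{flip}(a,a') ≤ 𝟙_B(a) 𝟙_B(a') + 𝟙_{¬close}(a,a')`. [folklore] -/
theorem flip_le {O : Y → ℝ} {B : Set Y} {Cl : Set (Y × Y)} (hflip : ∀ a a', (a, a') ∈ Cl → O a ≠ O a' → a ∈ B ∧ a' ∈ B) (a a' : Y) :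
    {q : Y × Y | O q.1 ≠ O q.2}.indicator (fun _ => (1 : ℝ)) (a, a') ≤
      B.indicator (fun _ => (1 : ℝ)) a * B.indicator (fun _ => (1 : ℝ)) a' + Clᶜ.indicator (fun _ => (1 : ℝ)) (a, a') := by
  have hB0 : ∀ y, 0 ≤ B.indicator (fun _ => (1 : ℝ)) y := fun y => Set.indicator_nonneg (fun _ _ => zero_le_one) _
  have hC0 : 0 ≤ Clᶜ.indicator (fun _ => (1 : ℝ)) (a, a') := Set.indicator_nonneg (fun _ _ => zero_le_one) _
  by_cases hne : O a ≠ O a'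
  · rw [Set.indicator_of_mem (show (a, a') ∈ {q : Y × Y | O q.1 ≠ O q.2} from hne)]
    by_cases hc : (a, a') ∈ Cl
    · obtain ⟨h1, h2⟩ := hflip a a' hc hne
      rw [Set.indicator_of_mem h1, Set.indicator_of_mem h2, mul_one]
      linarith
    · rw [Set.indicator_of_mem (show (a, a') ∈ Clᶜ from hc)]
      linarith [mul_nonneg (hB0 a) (hB0 a')]
  · rw [Set.indicator_of_notMem (show (a, a') ∉ {q : Y × Y | O q.1 ≠ O q.2} from hne)]
    exact add_nonneg (mul_nonneg (hB0 a) (hB0 a')) hC0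

omit [IsFiniteMeasure ρ] in
/-- Moving product weights between the bond slot and the two slice slots (pure algebra under the integral signs). [folklore] -/
theorem weight_conv (f g : Y → Y → ℝ) (R S : Y → Y) :
    ∫ x, ∫ a, Ψ (R x) a * ∫ a', K a a' * (f x a * g x a') * Ψ a' (S x) ∂ρ ∂ρ ∂ρ =
      ∫ x, ∫ a, (Ψ (R x) a * f x a) * ∫ a', K a a' * (Ψ a' (S x) * g x a') ∂ρ ∂ρ ∂ρ := by
  refine integral_congr_ae (ae_of_all _ fun x => integral_congr_ae (ae_of_all _ fun a => ?_))
  dsimp only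
  have h : ∫ a', K a a' * (f x a * g x a') * Ψ a' (S x) ∂ρ = f x a * ∫ a', K a a' * (Ψ a' (S x) * g x a') ∂ρ := by
    rw [← integral_const_mul]
    exact integral_congr_ae (ae_of_all _ fun a' => by ring)
  rw [h]
  ring

/-- One Cauchy–Schwarz term: for `[0,1]`-valued jointly measurable weights `f(x,a)` on the first half and `g(Sx, a')` on the second half,
`∫dx ⟨Ψ(x,·)f(x,·), K(Ψ(·,Sx) g(Sx,·))⟩ ≤ (∫dx ⟨Ψ(x,·)f, KΨ(·,x)f⟩)^{1/2} (∫dy ⟨Ψ(y,·)g, K Ψ(·,y)g⟩)^{1/2}` (`S` measure preserving,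
`Ψ` symmetric). [folklore] -/
theorem cs_term (hΨm : Measurable (uncurry Ψ)) (hΨb : ∀ x a, |Ψ x a| ≤ CΨ) (hΨ0 : ∀ x a, 0 ≤ Ψ x a) (hΨs : ∀ x a, Ψ x a = Ψ a x)
    (hKm : Measurable (uncurry K)) (hKb : ∀ a a', |K a a'| ≤ CK) (hK0 : ∀ a a', 0 ≤ K a a') (hKs : ∀ a a', K a a' = K a' a)
    (hPD : ∀ φ : Y → ℝ, Measurable φ → ∀ C : ℝ, (∀ a, |φ a| ≤ C) → 0 ≤ ∫ a, ∫ a', φ a * K a a' * φ a' ∂ρ ∂ρ)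
    {S : Y → Y} (hS : MeasurePreserving S ρ ρ) {f g : Y → Y → ℝ} (hf : Measurable (uncurry f)) (hg : Measurable (uncurry g))
    (hf0 : ∀ x a, 0 ≤ f x a) (hf1 : ∀ x a, f x a ≤ 1) (hg0 : ∀ x a, 0 ≤ g x a) (hg1 : ∀ x a, g x a ≤ 1) :
    ∫ x, ∫ a, (Ψ x a * f x a) * ∫ a', K a a' * (Ψ a' (S x) * g (S x) a') ∂ρ ∂ρ ∂ρ ≤
      Real.sqrt (∫ x, ∫ a, (Ψ x a * f x a) * ∫ a', K a a' * (Ψ a' x * f x a') ∂ρ ∂ρ ∂ρ) *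
        Real.sqrt (∫ x, ∫ a, (Ψ x a * g x a) * ∫ a', K a a' * (Ψ a' x * g x a') ∂ρ ∂ρ ∂ρ) := by
  have hSm : Measurable S := hS.measurable
  have hfb : ∀ x a, |f x a| ≤ 1 := fun x a => by rw [abs_of_nonneg (hf0 x a)]; exact hf1 x a
  have hgb : ∀ x a, |g x a| ≤ 1 := fun x a => by rw [abs_of_nonneg (hg0 x a)]; exact hg1 x a
  -- the three slice functions
  set A : Y → ℝ := fun x => ∫ a, (Ψ x a * f x a) * ∫ a', K a a' * (Ψ a' x * f x a') ∂ρ ∂ρ with hA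
  set Φ : Y → ℝ := fun y => ∫ a, (Ψ y a * g y a) * ∫ a', K a a' * (Ψ a' y * g y a') ∂ρ ∂ρ with hΦ
  have hΨm' : Measurable (uncurry fun x a => Ψ a x) := hΨm.comp (measurable_snd.prodMk measurable_fst)
  have hAm : Measurable A := measurable_pq (ρ := ρ) hKm hΨm hΨm' hf hf
  have hΦm : Measurable Φ := measurable_pq (ρ := ρ) hKm hΨm hΨm' hg hg
  have hA0 : ∀ x, 0 ≤ A x := fun x => pq_nonneg (ρ := ρ) hK0 hΨ0 (fun x a => hΨ0 a x) hf0 hf0 x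
  have hΦ0 : ∀ x, 0 ≤ Φ x := fun x => pq_nonneg (ρ := ρ) hK0 hΨ0 (fun x a => hΨ0 a x) hg0 hg0 x
  have hAb : ∀ x, A x ≤ CΨ * (CK * CΨ * ρ.real univ) * ρ.real univ := fun x =>
    (le_abs_self _).trans (abs_pq_le (ρ := ρ) hKb hΨb (fun x a => hΨb a x) hfb hfb x)
  have hΦb : ∀ x, Φ x ≤ CΨ * (CK * CΨ * ρ.real univ) * ρ.real univ := fun x =>
    (le_abs_self _).trans (abs_pq_le (ρ := ρ) hKb hΨb (fun x a => hΨb a x) hgb hgb x)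
  -- pointwise Cauchy–Schwarz: `LHS(x) ≤ √(A x) √(Φ (S x))`
  have hpt : ∀ x, ∫ a, (Ψ x a * f x a) * ∫ a', K a a' * (Ψ a' (S x) * g (S x) a') ∂ρ ∂ρ ≤ Real.sqrt (A x) * Real.sqrt (Φ (S x)) := by
    intro x
    have hfx : Measurable fun a => f x a := hf.comp (measurable_const.prodMk measurable_id)
    have hgx : Measurable fun a => g (S x) a := hg.comp (measurable_const.prodMk measurable_id)
    have h := inner_le_sqrt_mul_sqrt (ρ := ρ) (f := fun a => f x a) (g := fun a => g (S x) a) hΨm hΨb hKm hKb hKs hPD hfx hgx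
      (hfb x) (hgb (S x)) x (S x)
    have e1 : ∫ a, (Ψ x a * f x a) * ∫ a', K a a' * (Ψ x a' * f x a') ∂ρ ∂ρ = A x := by
      simp only [hA]
      refine integral_congr_ae (ae_of_all _ fun a => ?_)
      dsimp only
      congr 1
      exact integral_congr_ae (ae_of_all _ fun a' => by dsimp only; rw [hΨs x a'])
    have e2 : ∫ a, (Ψ a (S x) * g (S x) a) * ∫ a', K a a' * (Ψ a' (S x) * g (S x) a') ∂ρ ∂ρ = Φ (S x) := by
      simp only [hΦ]
      refine integral_congr_ae (ae_of_all _ fun a => ?_)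
      dsimp only
      rw [hΨs a (S x)]
    rw [e1, e2] at h
    exact h
  -- integrate and Cauchy–Schwarz in `x`
  have hLm : Measurable fun x => ∫ a, (Ψ x a * f x a) * ∫ a', K a a' * (Ψ a' (S x) * g (S x) a') ∂ρ ∂ρ :=
    measurable_pq (ρ := ρ) hKm hΨm (hΨm.comp (measurable_snd.prodMk (hSm.comp measurable_fst))) hf
      (hg.comp ((hSm.comp measurable_fst).prodMk measurable_snd))
  have hLb : ∀ x, |∫ a, (Ψ x a * f x a) * ∫ a', K a a' * (Ψ a' (S x) * g (S x) a') ∂ρ ∂ρ| ≤ CΨ * (CK * CΨ * ρ.real univ) * ρ.real univ :=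
    fun x => abs_pq_le (ρ := ρ) hKb hΨb (fun x a => hΨb a (S x)) hfb (fun x a => hgb (S x) a) x
  have hLi : Integrable (fun x => ∫ a, (Ψ x a * f x a) * ∫ a', K a a' * (Ψ a' (S x) * g (S x) a') ∂ρ ∂ρ) ρ :=
    Integrable.of_bound hLm.aestronglyMeasurable _ (ae_of_all _ fun x => by rw [Real.norm_eq_abs]; exact hLb x)
  set Cb : ℝ := CΨ * (CK * CΨ * ρ.real univ) * ρ.real univ with hCb
  have hRm : Measurable fun x => Real.sqrt (A x) * Real.sqrt (Φ (S x)) := hAm.sqrt.mul (hΦm.comp hSm).sqrt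
  have hRi : Integrable (fun x => Real.sqrt (A x) * Real.sqrt (Φ (S x))) ρ := by
    refine Integrable.of_bound hRm.aestronglyMeasurable (Real.sqrt Cb * Real.sqrt Cb) (ae_of_all _ fun x => ?_)
    rw [Real.norm_eq_abs, abs_of_nonneg (mul_nonneg (Real.sqrt_nonneg _) (Real.sqrt_nonneg _))]
    exact mul_le_mul (Real.sqrt_le_sqrt (hAb x)) (Real.sqrt_le_sqrt (hΦb (S x))) (Real.sqrt_nonneg _) (Real.sqrt_nonneg _)
  calc ∫ x, ∫ a, (Ψ x a * f x a) * ∫ a', K a a' * (Ψ a' (S x) * g (S x) a') ∂ρ ∂ρ ∂ρ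
      ≤ ∫ x, Real.sqrt (A x) * Real.sqrt (Φ (S x)) ∂ρ := integral_mono hLi hRi hpt
    _ ≤ Real.sqrt (∫ x, A x ∂ρ) * Real.sqrt (∫ x, Φ (S x) ∂ρ) :=
        integral_sqrt_mul_sqrt_le hAm (hΦm.comp hSm) hA0 (fun x => hΦ0 (S x)) hAb (fun x => hΦb (S x))
    _ = Real.sqrt (∫ x, A x ∂ρ) * Real.sqrt (∫ x, Φ x ∂ρ) := by rw [integral_comp_eq_of_mp hS hΦm]

omit [IsFiniteMeasure ρ] in
/-- Factorised insertions: `W[f ⊗ g, S]` in the two-slot form of `cs_term`. [folklore] -/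
theorem weight_eq_pq (f g : Y → Y → ℝ) (h : Y → Y → Y → ℝ) (S : Y → Y) (hfg : ∀ x a a', h x a a' = f x a * g x a') :
    ∫ x, ∫ a, Ψ x a * ∫ a', K a a' * h x a a' * Ψ a' (S x) ∂ρ ∂ρ ∂ρ =
      ∫ x, ∫ a, (Ψ x a * f x a) * ∫ a', K a a' * (Ψ a' (S x) * g x a') ∂ρ ∂ρ ∂ρ := by
  refine integral_congr_ae (ae_of_all _ fun x => integral_congr_ae (ae_of_all _ fun a => ?_))
  dsimp only
  have e : ∫ a', K a a' * h x a a' * Ψ a' (S x) ∂ρ = f x a * ∫ a', K a a' * (Ψ a' (S x) * g x a') ∂ρ := by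
    rw [← integral_const_mul]
    exact integral_congr_ae (ae_of_all _ fun a' => by dsimp only; rw [hfg]; ring)
  rw [e]
  ring

omit [IsFiniteMeasure ρ] in
/-- Factorised insertions, untwisted (`S = id`). [folklore] -/
theorem weight_eq_pq_id (f g : Y → Y → ℝ) (h : Y → Y → Y → ℝ) (hfg : ∀ x a a', h x a a' = f x a * g x a') :
    ∫ x, ∫ a, Ψ x a * ∫ a', K a a' * h x a a' * Ψ a' x ∂ρ ∂ρ ∂ρ =
      ∫ x, ∫ a, (Ψ x a * f x a) * ∫ a', K a a' * (Ψ a' x * g x a') ∂ρ ∂ρ ∂ρ :=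
  weight_eq_pq (ρ := ρ) f g h (fun x => x) hfg

/-- ★ **Flux reflection, odd ring.**  Let `Ψ ≥ 0` be bounded, jointly measurable and symmetric, `K ≥ 0` a bounded measurable symmetric positive
semi-definite kernel, `T` measure preserving with `O ∘ T = −O`, and let a flip of the bit `O` across a `close` pair force both points into `B`.  Then
the twisted ring weight is controlled by UNTWISTED ring weights:
`∫Ψ(x,a)K(a,a')Ψ(a',Tx) ≤ (∫ΨKΨ)^{1/2}·(2(∫Ψ𝟙_{flip}K𝟙_{flip}Ψ)^{1/2} + (∫𝟙_{O=0}ΨKΨ)^{1/2}) + ∫Ψ𝟙_B K 𝟙_B Ψ + ∫ΨK𝟙_{¬close}Ψ(·,T·)`.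
[folklore] -/
theorem twisted_le_odd (hΨm : Measurable (uncurry Ψ)) (hΨb : ∀ x a, |Ψ x a| ≤ CΨ) (hΨ0 : ∀ x a, 0 ≤ Ψ x a) (hΨs : ∀ x a, Ψ x a = Ψ a x)
    (hKm : Measurable (uncurry K)) (hKb : ∀ a a', |K a a'| ≤ CK) (hK0 : ∀ a a', 0 ≤ K a a') (hKs : ∀ a a', K a a' = K a' a)
    (hPD : ∀ φ : Y → ℝ, Measurable φ → ∀ C : ℝ, (∀ a, |φ a| ≤ C) → 0 ≤ ∫ a, ∫ a', φ a * K a a' * φ a' ∂ρ ∂ρ)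
    {T : Y → Y} (hT : MeasurePreserving T ρ ρ) {O : Y → ℝ} (hOm : Measurable O) (hOT : ∀ y, O (T y) = -O y)
    {B : Set Y} (hB : MeasurableSet B) {Cl : Set (Y × Y)} (hCl : MeasurableSet Cl)
    (hflip : ∀ a a', (a, a') ∈ Cl → O a ≠ O a' → a ∈ B ∧ a' ∈ B) :
    ∫ x, ∫ a, Ψ x a * ∫ a', K a a' * Ψ a' (T x) ∂ρ ∂ρ ∂ρ ≤
      Real.sqrt (∫ x, ∫ a, Ψ x a * ∫ a', K a a' * Ψ a' x ∂ρ ∂ρ ∂ρ) *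
          (2 * Real.sqrt (∫ x, ∫ a, Ψ x a * ∫ a', K a a' *
              ({b | O b ≠ O x}.indicator (fun _ => (1 : ℝ)) a * {b | O b ≠ O x}.indicator (fun _ => (1 : ℝ)) a') * Ψ a' x ∂ρ ∂ρ ∂ρ) +
            Real.sqrt (∫ x, ∫ a, Ψ x a * ∫ a', K a a' * {y | O y = 0}.indicator (fun _ => (1 : ℝ)) x * Ψ a' x ∂ρ ∂ρ ∂ρ)) +
        ∫ x, ∫ a, Ψ x a * ∫ a', K a a' * (B.indicator (fun _ => (1 : ℝ)) a * B.indicator (fun _ => (1 : ℝ)) a') * Ψ a' x ∂ρ ∂ρ ∂ρ +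
        ∫ x, ∫ a, Ψ x a * ∫ a', K a a' * Clᶜ.indicator (fun _ => (1 : ℝ)) (a, a') * Ψ a' (T x) ∂ρ ∂ρ ∂ρ := by
  have hTm : Measurable T := hT.measurable
  -- the insertions
  set z : Y → ℝ := fun x => {y | O y = 0}.indicator (fun _ => (1 : ℝ)) x with hz
  set fl : Y → Y → ℝ := fun x b => {b | O b ≠ O x}.indicator (fun _ => (1 : ℝ)) b with hfl
  set bB : Y → ℝ := fun b => B.indicator (fun _ => (1 : ℝ)) b with hbB
  set fq : Y → Y → ℝ := fun a a' => {q : Y × Y | O q.1 ≠ O q.2}.indicator (fun _ => (1 : ℝ)) (a, a') with hfq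
  set cl : Y → Y → ℝ := fun a a' => Clᶜ.indicator (fun _ => (1 : ℝ)) (a, a') with hcl
  -- measurability
  have hzm : Measurable z := measurable_const.indicator (measurableSet_eq_fun hOm measurable_const)
  have hflm : Measurable (uncurry fl) := measurable_flipInd hOm
  have hbBm : Measurable bB := measurable_const.indicator hB
  have hfqm : Measurable (uncurry fq) :=
    measurable_const.indicator ((measurableSet_eq_fun (hOm.comp measurable_fst) (hOm.comp measurable_snd)).compl)
  have hclm : Measurable (uncurry cl) := measurable_const.indicator hCl.compl
  have p1 : Measurable fun p : Y × Y × Y => p.1 := measurable_fst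
  have p2 : Measurable fun p : Y × Y × Y => p.2.1 := measurable_fst.comp measurable_snd
  have p3 : Measurable fun p : Y × Y × Y => p.2.2 := measurable_snd.comp measurable_snd
  -- three-slot insertions
  have mH0 : Measurable fun _ : Y × Y × Y => (1 : ℝ) := measurable_const
  have mZ : Measurable fun p : Y × Y × Y => z p.1 := hzm.comp p1
  have mF1 : Measurable fun p : Y × Y × Y => fl p.1 p.2.1 := hflm.comp (p1.prodMk p2)
  have mF2 : Measurable fun p : Y × Y × Y => fl (T p.1) p.2.2 := hflm.comp ((hTm.comp p1).prodMk p3)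
  have mQ : Measurable fun p : Y × Y × Y => fq p.2.1 p.2.2 := hfqm.comp (p2.prodMk p3)
  have mBB : Measurable fun p : Y × Y × Y => bB p.2.1 * bB p.2.2 := (hbBm.comp p2).mul (hbBm.comp p3)
  have mC : Measurable fun p : Y × Y × Y => cl p.2.1 p.2.2 := hclm.comp (p2.prodMk p3)
  -- bounds
  have b1 : ∀ (s : Set Y) (y : Y), |s.indicator (fun _ => (1 : ℝ)) y| ≤ 1 := abs_ind_le_one
  have bZ : ∀ x a a' : Y, |z x| ≤ 1 := fun x _ _ => b1 _ x
  have bF1 : ∀ x a a' : Y, |fl x a| ≤ 1 := fun x a _ => b1 _ a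
  have bF2 : ∀ x a a' : Y, |fl (T x) a'| ≤ 1 := fun x _ a' => b1 _ a'
  have bQ : ∀ x a a' : Y, |fq a a'| ≤ 1 := fun _ a a' => abs_ind_le_one (Y := Y × Y) _ (a, a')
  have bBB : ∀ x a a' : Y, |bB a * bB a'| ≤ 1 := fun _ a a' => by
    rw [abs_mul]; exact (mul_le_mul (b1 B a) (b1 B a') (abs_nonneg _) zero_le_one).trans (by rw [mul_one])
  have bC : ∀ x a a' : Y, |cl a a'| ≤ 1 := fun _ a a' => abs_ind_le_one (Y := Y × Y) _ (a, a')
  have bH0 : ∀ x a a' : Y, |(1 : ℝ)| ≤ 1 := fun _ _ _ => by simp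
  have bBr : ∀ x a a' : Y, |z x + fl x a + fl (T x) a' + fq a a'| ≤ 4 := fun x a a' => by
    have h1 := bZ x a a'; have h2 := bF1 x a a'; have h3 := bF2 x a a'; have h4 := bQ x a a'
    calc |z x + fl x a + fl (T x) a' + fq a a'| ≤ |z x + fl x a + fl (T x) a'| + |fq a a'| := abs_add_le _ _
      _ ≤ |z x + fl x a| + |fl (T x) a'| + |fq a a'| := by linarith [abs_add_le (z x + fl x a) (fl (T x) a')]
      _ ≤ |z x| + |fl x a| + |fl (T x) a'| + |fq a a'| := by linarith [abs_add_le (z x) (fl x a)]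
      _ ≤ 4 := by linarith
  have bZF : ∀ x a a' : Y, |z x + fl x a| ≤ 2 := fun x a a' => by
    linarith [abs_add_le (z x) (fl x a), bZ x a a', bF1 x a a']
  have bZFF : ∀ x a a' : Y, |z x + fl x a + fl (T x) a'| ≤ 3 := fun x a a' => by
    linarith [abs_add_le (z x + fl x a) (fl (T x) a'), bZF x a a', bF2 x a a']
  have bBC : ∀ x a a' : Y, |bB a * bB a' + cl a a'| ≤ 2 := fun x a a' => by
    linarith [abs_add_le (bB a * bB a') (cl a a'), bBB x a a', bC x a a']
  -- Step 1: insert the bracket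
  have step1 : ∫ x, ∫ a, Ψ x a * ∫ a', K a a' * 1 * Ψ a' (T x) ∂ρ ∂ρ ∂ρ ≤
      ∫ x, ∫ a, Ψ x a * ∫ a', K a a' * (z x + fl x a + fl (T x) a' + fq a a') * Ψ a' (T x) ∂ρ ∂ρ ∂ρ :=
    weight_mono (H := fun _ _ _ => (1 : ℝ)) (H' := fun x a a' => z x + fl x a + fl (T x) a' + fq a a') hΨm hΨb hΨ0 hKm hKb hK0 mH0
      (((mZ.add mF1).add mF2).add mQ) bH0 bBr (fun x a a' => one_le_bracket hOT x a a') hTm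
  have e0 : ∫ x, ∫ a, Ψ x a * ∫ a', K a a' * 1 * Ψ a' (T x) ∂ρ ∂ρ ∂ρ = ∫ x, ∫ a, Ψ x a * ∫ a', K a a' * Ψ a' (T x) ∂ρ ∂ρ ∂ρ := by
    simp only [mul_one]
  -- Step 2: split the bracket
  have e2a : ∫ x, ∫ a, Ψ x a * ∫ a', K a a' * (z x + fl x a + fl (T x) a' + fq a a') * Ψ a' (T x) ∂ρ ∂ρ ∂ρ =
      (∫ x, ∫ a, Ψ x a * ∫ a', K a a' * (z x + fl x a + fl (T x) a') * Ψ a' (T x) ∂ρ ∂ρ ∂ρ) +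
        ∫ x, ∫ a, Ψ x a * ∫ a', K a a' * fq a a' * Ψ a' (T x) ∂ρ ∂ρ ∂ρ :=
    weight_add (H := fun x a a' => z x + fl x a + fl (T x) a') (H' := fun _ a a' => fq a a') hΨm hΨb hKm hKb ((mZ.add mF1).add mF2) mQ bZFF bQ hTm
  have e2b : ∫ x, ∫ a, Ψ x a * ∫ a', K a a' * (z x + fl x a + fl (T x) a') * Ψ a' (T x) ∂ρ ∂ρ ∂ρ =
      (∫ x, ∫ a, Ψ x a * ∫ a', K a a' * (z x + fl x a) * Ψ a' (T x) ∂ρ ∂ρ ∂ρ) +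
        ∫ x, ∫ a, Ψ x a * ∫ a', K a a' * fl (T x) a' * Ψ a' (T x) ∂ρ ∂ρ ∂ρ :=
    weight_add (H := fun x a _ => z x + fl x a) (H' := fun x _ a' => fl (T x) a') hΨm hΨb hKm hKb (mZ.add mF1) mF2 bZF bF2 hTm
  have e2c : ∫ x, ∫ a, Ψ x a * ∫ a', K a a' * (z x + fl x a) * Ψ a' (T x) ∂ρ ∂ρ ∂ρ =
      (∫ x, ∫ a, Ψ x a * ∫ a', K a a' * z x * Ψ a' (T x) ∂ρ ∂ρ ∂ρ) +
        ∫ x, ∫ a, Ψ x a * ∫ a', K a a' * fl x a * Ψ a' (T x) ∂ρ ∂ρ ∂ρ :=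
    weight_add (H := fun x _ _ => z x) (H' := fun x a _ => fl x a) hΨm hΨb hKm hKb mZ mF1 bZ bF1 hTm
  -- Step 3: a middle flip is in the band or across a bad bond
  have step3 : ∫ x, ∫ a, Ψ x a * ∫ a', K a a' * fq a a' * Ψ a' (T x) ∂ρ ∂ρ ∂ρ ≤
      ∫ x, ∫ a, Ψ x a * ∫ a', K a a' * (bB a * bB a' + cl a a') * Ψ a' (T x) ∂ρ ∂ρ ∂ρ :=
    weight_mono (H := fun _ a a' => fq a a') (H' := fun _ a a' => bB a * bB a' + cl a a') hΨm hΨb hΨ0 hKm hKb hK0 mQ (mBB.add mC) bQ bBC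
      (fun _ a a' => flip_le hflip a a') hTm
  have e3 : ∫ x, ∫ a, Ψ x a * ∫ a', K a a' * (bB a * bB a' + cl a a') * Ψ a' (T x) ∂ρ ∂ρ ∂ρ =
      (∫ x, ∫ a, Ψ x a * ∫ a', K a a' * (bB a * bB a') * Ψ a' (T x) ∂ρ ∂ρ ∂ρ) +
        ∫ x, ∫ a, Ψ x a * ∫ a', K a a' * cl a a' * Ψ a' (T x) ∂ρ ∂ρ ∂ρ :=
    weight_add (H := fun _ a a' => bB a * bB a') (H' := fun _ a a' => cl a a') hΨm hΨb hKm hKb mBB mC bBB bC hTm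
  -- Step 4: the four Cauchy–Schwarz bounds
  have hz0 : ∀ x a : Y, 0 ≤ z x := fun x _ => ind_nonneg _ x
  have hz1 : ∀ x a : Y, z x ≤ 1 := fun x _ => ind_le_one _ x
  have hfl0 : ∀ x a : Y, 0 ≤ fl x a := fun x a => ind_nonneg _ a
  have hfl1 : ∀ x a : Y, fl x a ≤ 1 := fun x a => ind_le_one _ a
  have hbB0 : ∀ x a : Y, 0 ≤ bB a := fun _ a => ind_nonneg _ a
  have hbB1 : ∀ x a : Y, bB a ≤ 1 := fun _ a => ind_le_one _ a
  -- (E1) the zero term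
  have E1 := cs_term (ρ := ρ) (f := fun x _ => z x) (g := fun _ _ => (1 : ℝ)) hΨm hΨb hΨ0 hΨs hKm hKb hK0 hKs hPD hT
    (hzm.comp measurable_fst) measurable_const hz0 hz1 (fun _ _ => zero_le_one) (fun _ _ => le_rfl)
  have cz1 : ∫ x, ∫ a, Ψ x a * ∫ a', K a a' * z x * Ψ a' (T x) ∂ρ ∂ρ ∂ρ =
      ∫ x, ∫ a, (Ψ x a * z x) * ∫ a', K a a' * (Ψ a' (T x) * 1) ∂ρ ∂ρ ∂ρ :=
    weight_eq_pq (fun x _ => z x) (fun _ _ => (1 : ℝ)) (fun x _ _ => z x) T (fun _ _ _ => by ring)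
  have cz2 : ∫ x, ∫ a, Ψ x a * ∫ a', K a a' * z x * Ψ a' x ∂ρ ∂ρ ∂ρ =
      ∫ x, ∫ a, (Ψ x a * z x) * ∫ a', K a a' * (Ψ a' x * z x) ∂ρ ∂ρ ∂ρ :=
    weight_eq_pq_id (fun x _ => z x) (fun x _ => z x) (fun x _ _ => z x) (fun x _ _ => by rw [ind_mul_self])
  have c11 : ∫ x, ∫ a, Ψ x a * ∫ a', K a a' * Ψ a' x ∂ρ ∂ρ ∂ρ = ∫ x, ∫ a, (Ψ x a * 1) * ∫ a', K a a' * (Ψ a' x * 1) ∂ρ ∂ρ ∂ρ := by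
    simp only [mul_one]
  rw [← cz1, ← cz2, ← c11] at E1
  -- (E2) flip on the first half
  have E2 := cs_term (ρ := ρ) (f := fun x a => fl x a) (g := fun _ _ => (1 : ℝ)) hΨm hΨb hΨ0 hΨs hKm hKb hK0 hKs hPD hT
    hflm measurable_const hfl0 hfl1 (fun _ _ => zero_le_one) (fun _ _ => le_rfl)
  have cf1 : ∫ x, ∫ a, Ψ x a * ∫ a', K a a' * fl x a * Ψ a' (T x) ∂ρ ∂ρ ∂ρ =
      ∫ x, ∫ a, (Ψ x a * fl x a) * ∫ a', K a a' * (Ψ a' (T x) * 1) ∂ρ ∂ρ ∂ρ :=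
    weight_eq_pq (fun x a => fl x a) (fun _ _ => (1 : ℝ)) (fun x a _ => fl x a) T (fun _ _ _ => by ring)
  have cf2 : ∫ x, ∫ a, Ψ x a * ∫ a', K a a' * (fl x a * fl x a') * Ψ a' x ∂ρ ∂ρ ∂ρ =
      ∫ x, ∫ a, (Ψ x a * fl x a) * ∫ a', K a a' * (Ψ a' x * fl x a') ∂ρ ∂ρ ∂ρ :=
    weight_eq_pq_id (fun x a => fl x a) (fun x a' => fl x a') (fun x a a' => fl x a * fl x a') (fun _ _ _ => rfl)
  rw [← cf1, ← cf2, ← c11] at E2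
  -- (E3) flip on the second half
  have E3 := cs_term (ρ := ρ) (f := fun _ _ => (1 : ℝ)) (g := fun y b => fl y b) hΨm hΨb hΨ0 hΨs hKm hKb hK0 hKs hPD hT
    measurable_const hflm (fun _ _ => zero_le_one) (fun _ _ => le_rfl) hfl0 hfl1
  have cg1 : ∫ x, ∫ a, Ψ x a * ∫ a', K a a' * fl (T x) a' * Ψ a' (T x) ∂ρ ∂ρ ∂ρ =
      ∫ x, ∫ a, (Ψ x a * 1) * ∫ a', K a a' * (Ψ a' (T x) * fl (T x) a') ∂ρ ∂ρ ∂ρ :=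
    weight_eq_pq (fun _ _ => (1 : ℝ)) (fun x a' => fl (T x) a') (fun x _ a' => fl (T x) a') T (fun _ _ _ => by ring)
  rw [← cg1, ← cf2, ← c11] at E3
  -- (E4) the band
  have E4 := cs_term (ρ := ρ) (f := fun _ a => bB a) (g := fun _ b => bB b) hΨm hΨb hΨ0 hΨs hKm hKb hK0 hKs hPD hT
    (hbBm.comp measurable_snd) (hbBm.comp measurable_snd) hbB0 hbB1 hbB0 hbB1
  have cb1 : ∫ x, ∫ a, Ψ x a * ∫ a', K a a' * (bB a * bB a') * Ψ a' (T x) ∂ρ ∂ρ ∂ρ =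
      ∫ x, ∫ a, (Ψ x a * bB a) * ∫ a', K a a' * (Ψ a' (T x) * bB a') ∂ρ ∂ρ ∂ρ :=
    weight_eq_pq (fun _ a => bB a) (fun _ a' => bB a') (fun _ a a' => bB a * bB a') T (fun _ _ _ => rfl)
  have cb2 : ∫ x, ∫ a, Ψ x a * ∫ a', K a a' * (bB a * bB a') * Ψ a' x ∂ρ ∂ρ ∂ρ =
      ∫ x, ∫ a, (Ψ x a * bB a) * ∫ a', K a a' * (Ψ a' x * bB a') ∂ρ ∂ρ ∂ρ :=
    weight_eq_pq_id (fun _ a => bB a) (fun _ a' => bB a') (fun _ a a' => bB a * bB a') (fun _ _ _ => rfl)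
  rw [← cb1, ← cb2] at E4
  have hband0 : 0 ≤ ∫ x, ∫ a, Ψ x a * ∫ a', K a a' * (bB a * bB a') * Ψ a' x ∂ρ ∂ρ ∂ρ := by
    rw [cb2]; exact integral_nonneg fun x => pq_nonneg (ρ := ρ) hK0 hΨ0 (fun x a => hΨ0 a x) hbB0 hbB0 x
  rw [Real.mul_self_sqrt hband0] at E4
  -- Step 5: collect
  have total : ∫ x, ∫ a, Ψ x a * ∫ a', K a a' * Ψ a' (T x) ∂ρ ∂ρ ∂ρ ≤
      Real.sqrt (∫ x, ∫ a, Ψ x a * ∫ a', K a a' * z x * Ψ a' x ∂ρ ∂ρ ∂ρ) *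
          Real.sqrt (∫ x, ∫ a, Ψ x a * ∫ a', K a a' * Ψ a' x ∂ρ ∂ρ ∂ρ) +
        Real.sqrt (∫ x, ∫ a, Ψ x a * ∫ a', K a a' * (fl x a * fl x a') * Ψ a' x ∂ρ ∂ρ ∂ρ) *
          Real.sqrt (∫ x, ∫ a, Ψ x a * ∫ a', K a a' * Ψ a' x ∂ρ ∂ρ ∂ρ) +
        Real.sqrt (∫ x, ∫ a, Ψ x a * ∫ a', K a a' * Ψ a' x ∂ρ ∂ρ ∂ρ) *
          Real.sqrt (∫ x, ∫ a, Ψ x a * ∫ a', K a a' * (fl x a * fl x a') * Ψ a' x ∂ρ ∂ρ ∂ρ) +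
        ∫ x, ∫ a, Ψ x a * ∫ a', K a a' * (bB a * bB a') * Ψ a' x ∂ρ ∂ρ ∂ρ +
        ∫ x, ∫ a, Ψ x a * ∫ a', K a a' * cl a a' * Ψ a' (T x) ∂ρ ∂ρ ∂ρ := by
    linarith
  refine total.trans (le_of_eq ?_)
  ring

end Odd

end Summit.QuantumFields.YangMills.Theorems.FemtoTransferGap.FluxReflection

end
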